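import Summits.RiemannHypothesis.RiemannHypothesis.Theorems.WeilGroundStateGroundStatesConvergeToXiStubWeakLimitMellinPointwise
import Summits.RiemannHypothesis.RiemannHypothesis.Theorems.WeilGroundStateGroundStatesConvergeToXiStubWeakLimitMellinLocallyUniform
import Summits.RiemannHypothesis.RiemannHypothesis.Theorems.WeilGroundStateGroundStatesConvergeToXiWeakLimitHarmonic
import Summits.RiemannHypothesis.RiemannHypothesis.Theorems.WeilGroundStateGroundStatesConvergeToXiLineExactWeak
import Summits.RiemannHypothesis.RiemannHypothesis.Theorems.WeilGroundStateGroundStatesConvergeToXiTransfer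
import Summits.RiemannHypothesis.RiemannHypothesis.Theorems.WeilGroundStateGroundStateMellinRealZeros
import Summits.RiemannHypothesis.RiemannHypothesis.Theorems.GroundStatesConvergeToXi.Negative.NotAttained
import Summits.RiemannHypothesis.RiemannHypothesis.Theses.WeilGroundState
import Literature.NumberTheory.LFunctions.WeilExplicit
import Literature.NumberTheory.LFunctions.WeilGroundState
import Literature.Analysis.Complex.Hurwitz
import HarnessLib

/-!
# `WeilGroundState.GroundStatesConvergeToXi` — the MELLIN side of the weak-limit programme for a
general limit, NV × IDENT ⇒ crux, and the Hurwitz signature of tight weak limits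
(crux item stmt-RiemannHypothesis-1527, route route-RiemannHypothesis-WeilGroundState; line `Sketch`,
lead file of rev L11b, continuation lead c9; `--supports`)

Let `u_k` be operator-free Weil ground states at windows `a_k → ∞`, `c_k` scalars with `c_k u_k`
TIGHT in every weighted `L¹(e^{b|t|})`, `b < 1/2`, converging weakly against test functions to
`v` (a.e.-strongly measurable, `∫ ‖v‖ e^{b|t|} < ∞` for every `b < 1/2`).  Then

* `weakLimit_mellin_locallyUniform` (M2 ∘ M1, RH-free) — **`c_k û_k → v̂` locally uniformly on
  the open critical strip** (the landed transfer to `ξ` is the case `v = Φ`).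
* `ae_eq_zero_of_weilMellin_criticalLine` — Mellin uniqueness in the tree's vocabulary: an
  integrable `v` with `v̂ = 0` on the critical line vanishes a.e. (pairing identity
  `∫ v g = ∫ 𝓕v · 𝓕⁻g`, `𝓕v(ξ) = v̂(1/2 − 2πiξ)`).
* `stub_weakLimit_hurwitz` / `weakLimit_hurwitz` — **the HURWITZ SIGNATURE, conditional on the
  open crux `GroundStateSimpleEven`**: if moreover `c_k u_k` is bounded in ONE `L¹(e^{b₀|t|})`,
  `b₀ > 1/2`, then EITHER `v = 0` a.e. OR `v̂` is ZERO-FREE on the right open half-strip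
  `{1/2 < Re s < 1}` (Connes–van Suijlekom, `groundStateMellinRealZeros_proof`: the approximants
  are zero-free off the line; Hurwitz; the alternative `v̂ ≡ 0` on the half-strip propagates to the
  strip by the identity theorem and forces `v = 0` a.e.).  Together with the RH-free pinning
  `v̂(ρ) = 0` at every non-trivial zero (`weakLimit_weilMellin_eq_zero`) this recovers, under
  `GroundStateSimpleEven`, "non-zero tight limit ⇒ no zero of `ζ` in the half-strip"; its new
  content is a constraint on the SHAPE of admissible limits (`v̂/ξ` zero-free off the line).
* `groundStatesConvergeToXi_of_weakLimit_const_mul_phi` — **NV × IDENT ⇒ the crux**: a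
  `b₀ > 1/2`-tight sequence converging weakly to a NON-ZERO MULTIPLE `m·Φ` of Riemann's kernel gives
  `GroundStatesConvergeToXi` (rescale by `m⁻¹`, transfer).

Mathlib + proved tree files (M1, M2, rev L11 `…WeakLimitHarmonic`, `…LineExactWeak`, `…Transfer`,
`…GroundStateMellinRealZeros`, `Negative/NotAttained`, `Literature.Analysis.Complex.Hurwitz`); the
only hypothesis of `Prop`-type is the ROUTE ITEM `GroundStateSimpleEven` (stmt-1526, open), taken
explicitly; no definitions.
-/

noncomputable section

set_option linter.dupNamespace false

open scoped Topology Real ComplexConjugate FourierTransform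
open Filter Set MeasureTheory Complex

namespace Summit.RiemannHypothesis.RiemannHypothesis.Theorems.GroundStatesConvergeToXi

open Literature.NumberTheory.LFunctions
open Summit.RiemannHypothesis.RiemannHypothesis.Theses.WeilGroundState

/-! ## The Mellin transforms of tight weak limits (M2 ∘ M1) -/

/-- **Tight weak limits on the Mellin side (RH-free).**  If `c_k u_k` (ground states `u_k` at
windows `a_k`) is tight in every `L¹(e^{b|t|})`, `b < 1/2`, and converges weakly against tests to
`v` with `∫‖v‖e^{b|t|} < ∞` for all `b < 1/2`, then `c_k û_k → v̂` locally uniformly on the open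
critical strip, and `v̂` is holomorphic there. [folklore] -/
theorem weakLimit_mellin_locallyUniform {a : ℕ → ℝ} {u : ℕ → ℝ → ℂ} {c : ℕ → ℂ} {v : ℝ → ℂ}
    (hu : ∀ k, IsWeilGroundState (a k) (u k))
    (htight : ∀ b : ℝ, b < 1 / 2 → ∃ M : ℝ, ∀ k, ∫ t, ‖c k * u k t‖ * Real.exp (b * |t|) ≤ M)
    (hv : AEStronglyMeasurable v volume)
    (hvI : ∀ b : ℝ, b < 1 / 2 → Integrable (fun t : ℝ => ‖v t‖ * Real.exp (b * |t|)))
    (hweak : ∀ g : ℝ → ℂ, IsWeilTest g →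
      Tendsto (fun k => ∫ t, c k * u k t * g t) atTop (𝓝 (∫ t, v t * g t))) :
    DifferentiableOn ℂ (weilMellin v) {s : ℂ | 0 < s.re ∧ s.re < 1} ∧
      TendstoLocallyUniformlyOn (fun k s => c k * weilMellin (u k) s) (weilMellin v) atTop
        {s : ℂ | 0 < s.re ∧ s.re < 1} := by
  obtain ⟨hd, hpt⟩ := stub_weakLimit_mellin_pointwise a u c v hu htight hv hvI hweak
  exact ⟨hd, stub_weakLimit_mellin_locallyUniform a u c (weilMellin v) hu htight hd hpt⟩

/-! ## Mellin uniqueness -/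

/-- **An integrable function whose Mellin transform vanishes on the critical line is `0` a.e.**
(`𝓕v(ξ) = v̂(1/2 − 2πiξ)`, pairing identity `∫ v g = ∫ 𝓕v · 𝓕⁻g` against every test `g`, then
`ae_eq_zero_of_forall_isWeilTest`). [folklore] -/
theorem ae_eq_zero_of_weilMellin_criticalLine {v : ℝ → ℂ} (hv : Integrable v)
    (h : ∀ τ : ℝ, weilMellin v (1 / 2 + τ * I) = 0) : v =ᵐ[volume] 0 := by
  refine ae_eq_zero_of_forall_isWeilTest hv.locallyIntegrable fun g hg => ?_
  rw [integral_mul_eq_integral_fourier_mul_fourierInv hv hg]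
  refine integral_eq_zero_of_ae (ae_of_all _ fun ξ => ?_)
  have h1 : 𝓕 v ξ = 0 := by
    rw [Negative.fourier_eq_weilMellin]
    exact_mod_cast h (-2 * π * ξ)
  simp [h1]

/-- A function with `∫‖v‖e^{b|t|} < ∞` for all `b < 1/2` is integrable (take `b = 0`). [folklore] -/
theorem integrable_of_weighted_all {v : ℝ → ℂ} (hv : AEStronglyMeasurable v volume)
    (hvI : ∀ b : ℝ, b < 1 / 2 → Integrable (fun t : ℝ => ‖v t‖ * Real.exp (b * |t|))) :
    Integrable v :=
  scPair_integrable hv le_rfl (hvI 0 (by norm_num))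

/-! ## The Hurwitz signature of tight weak limits (conditional on `GroundStateSimpleEven`) -/

/-- **Hurwitz signature of tight weak limits** (conditional on the route item
`GroundStateSimpleEven`, stmt-1526).  Ground states `u_k` at windows `a_k → ∞`, scalars `c_k` with
`c_k u_k` bounded in ONE `L¹(e^{b₀|t|})`, `b₀ > 1/2`, converging weakly against tests to a locally
integrable `v`: then EITHER `v = 0` a.e., OR `v̂ = weilMellin v` has NO ZERO in the right open
half-strip `{1/2 < Re s < 1}`.  Proof: if some test pairs non-trivially with `v`, the pairings
`⟨c_k u_k, g₀⟩` are eventually non-zero, so `c_k ≠ 0` eventually; by Connes–van Suijlekom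
(`groundStateMellinRealZeros_proof`, hypothesis discharged by `GroundStateSimpleEven` at `a_k`)
each `û_k` is zero-free off the critical line, hence `c_k û_k` is zero-free on the half-strip
eventually; `c_k û_k → v̂` locally uniformly there (`weakLimit_mellin_locallyUniform`, tightness for
`b < 1/2` from `b₀ > 1/2`, weighted integrability of `v` from H5); Hurwitz gives `v̂ ≡ 0` on the
half-strip or zero-free; in the first case the identity theorem on the strip and Mellin uniqueness
force `v = 0` a.e., contradicting the non-trivial pairing. [folklore] -/
theorem stub_weakLimit_hurwitz :
    Summit.RiemannHypothesis.RiemannHypothesis.Theses.WeilGroundState.GroundStateSimpleEven →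
    ∀ (a : ℕ → ℝ) (u : ℕ → ℝ → ℂ) (c : ℕ → ℂ) (v : ℝ → ℂ) (b₀ M : ℝ),
      Tendsto a atTop atTop → (∀ k, IsWeilGroundState (a k) (u k)) → 1 / 2 < b₀ →
      (∀ k, ∫ t, ‖c k * u k t‖ * Real.exp (b₀ * |t|) ≤ M) →
      LocallyIntegrable v volume →
      (∀ g : ℝ → ℂ, IsWeilTest g →
        Tendsto (fun k => ∫ t, c k * u k t * g t) atTop (𝓝 (∫ t, v t * g t))) →
      v =ᵐ[volume] 0 ∨ ∀ s : ℂ, 1 / 2 < s.re → s.re < 1 → weilMellin v s ≠ 0 := by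
  intro h₁ a u c v b₀ M ha hu hb₀ hM hvloc hweak
  classical
  by_cases hnull : ∀ g : ℝ → ℂ, IsWeilTest g → ∫ t, v t * g t = 0
  · exact Or.inl (ae_eq_zero_of_forall_isWeilTest hvloc hnull)
  right
  push Not at hnull
  obtain ⟨g₀, hg₀, hne⟩ := hnull
  -- weighted integrability of `v` (H5) and tightness for every `b < 1/2`
  obtain ⟨⟨hvint, -⟩, -, -⟩ := weakLimit_harmonic_of_locallyIntegrable ha hu hb₀ hM hvloc hweak
  have hvm : AEStronglyMeasurable v volume := hvloc.aestronglyMeasurable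
  have hfi : ∀ k, Integrable (fun t : ℝ => ‖c k * u k t‖ * Real.exp (b₀ * |t|)) := by
    intro k
    refine (((hu k).integrable_norm_mul_exp b₀).const_mul ‖c k‖).congr (ae_of_all _ fun t => ?_)
    simp only [norm_mul]
    ring
  have hmono : ∀ {w : ℝ → ℂ} {b : ℝ}, AEStronglyMeasurable w volume → b < 1 / 2 →
      Integrable (fun t : ℝ => ‖w t‖ * Real.exp (b₀ * |t|)) →
      Integrable (fun t : ℝ => ‖w t‖ * Real.exp (b * |t|)) ∧
        ∫ t, ‖w t‖ * Real.exp (b * |t|) ≤ ∫ t, ‖w t‖ * Real.exp (b₀ * |t|) := by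
    intro w b hw hb hI
    have hle : ∀ t, ‖w t‖ * Real.exp (b * |t|) ≤ ‖w t‖ * Real.exp (b₀ * |t|) := fun t =>
      mul_le_mul_of_nonneg_left
        (Real.exp_le_exp.2 (mul_le_mul_of_nonneg_right (by linarith) (abs_nonneg t)))
        (norm_nonneg _)
    have hI' : Integrable (fun t : ℝ => ‖w t‖ * Real.exp (b * |t|)) :=
      hI.mono' (hw.norm.mul (by fun_prop : Continuous fun t : ℝ =>
          Real.exp (b * |t|)).aestronglyMeasurable)
        (ae_of_all _ fun t => by
          rw [Real.norm_of_nonneg (by positivity)]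
          exact hle t)
    exact ⟨hI', integral_mono_of_nonneg (ae_of_all _ fun t => by positivity) hI
      (ae_of_all _ fun t => hle t)⟩
  have hfm : ∀ k, AEStronglyMeasurable (fun t => c k * u k t) volume := fun k =>
    ((hu k).integrable.const_mul (c k)).aestronglyMeasurable
  have htight : ∀ b : ℝ, b < 1 / 2 → ∃ M' : ℝ, ∀ k,
      ∫ t, ‖c k * u k t‖ * Real.exp (b * |t|) ≤ M' := fun b hb =>
    ⟨M, fun k => ((hmono (hfm k) hb (hfi k)).2).trans (hM k)⟩
  have hvI : ∀ b : ℝ, b < 1 / 2 → Integrable (fun t : ℝ => ‖v t‖ * Real.exp (b * |t|)) :=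
    fun b hb => (hmono hvm hb hvint).1
  -- the Mellin side
  obtain ⟨hd, hlim⟩ := weakLimit_mellin_locallyUniform hu htight hvm hvI hweak
  -- `c k ≠ 0` eventually, from the non-trivial pairing
  have hc : ∀ᶠ k in atTop, c k ≠ 0 := by
    have h := hweak g₀ hg₀
    filter_upwards [h.eventually_ne hne] with k hk hck
    apply hk
    refine integral_eq_zero_of_ae (ae_of_all _ fun t => ?_)
    simp [hck]
  -- Hurwitz on the right half-strip
  set U : Set ℂ := {s : ℂ | 1 / 2 < s.re ∧ s.re < 1} with hUdef
  have hUo : IsOpen U :=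
    (isOpen_lt continuous_const Complex.continuous_re).inter
      (isOpen_lt Complex.continuous_re continuous_const)
  have hUc : Convex ℝ U := (convex_halfSpace_re_gt (1 / 2)).inter (convex_halfSpace_re_lt 1)
  have hUsub : U ⊆ {s : ℂ | 0 < s.re ∧ s.re < 1} := fun s hs => ⟨by linarith [hs.1], hs.2⟩
  have hlimU : TendstoLocallyUniformlyOn (fun k s => c k * weilMellin (u k) s) (weilMellin v)
      atTop U := hlim.mono hUsub
  have hFd : ∀ᶠ k in atTop, DifferentiableOn ℂ (fun s => c k * weilMellin (u k) s) U :=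
    Eventually.of_forall fun k =>
      ((differentiable_const (c k)).mul (hu k).differentiable_weilMellin).differentiableOn
  have hFne : ∃ᶠ k in atTop, ∀ z ∈ U, c k * weilMellin (u k) z ≠ 0 := by
    refine hc.frequently.mono fun k hck z hz hz0 => ?_
    rcases mul_eq_zero.1 hz0 with h0 | h0
    · exact hck h0
    · obtain ⟨hmem, g, hg, hQ, hL2⟩ := hu k
      obtain ⟨-, hzero⟩ := groundStateMellinRealZeros_proof (a k) (hu k).pos
        (h₁ (a k) (hu k).pos) (u k) hmem ⟨g, hg, hQ, hL2⟩
      have := hzero z h0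
      linarith [hz.1]
  rcases Complex.hurwitz_eqOn_zero_or_forall_ne_zero hUo hUc.isPreconnected hFd hlimU hFne with
    hzero | hne'
  · -- `v̂ ≡ 0` on `U`, hence on the strip (identity theorem), hence `v = 0` a.e.: contradiction
    exfalso
    set S : Set ℂ := {s : ℂ | 0 < s.re ∧ s.re < 1} with hSdef
    have hSo : IsOpen S :=
      (isOpen_lt continuous_const Complex.continuous_re).inter
        (isOpen_lt Complex.continuous_re continuous_const)
    have hSc : IsPreconnected S :=
      ((convex_halfSpace_re_gt (0 : ℝ)).inter (convex_halfSpace_re_lt 1)).isPreconnected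
    have han : AnalyticOnNhd ℂ (weilMellin v) S := hd.analyticOnNhd hSo
    have hz₀ : ((3 : ℂ) / 4) ∈ S := by
      refine ⟨?_, ?_⟩ <;> norm_num
    have hz₀U : ((3 : ℂ) / 4) ∈ U := by
      refine ⟨?_, ?_⟩ <;> norm_num
    have hev : weilMellin v =ᶠ[𝓝 ((3 : ℂ) / 4)] 0 :=
      Filter.eventuallyEq_of_mem (hUo.mem_nhds hz₀U) hzero
    have hall : EqOn (weilMellin v) 0 S :=
      han.eqOn_zero_of_preconnected_of_eventuallyEq_zero hSc hz₀ hev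
    have hline : ∀ τ : ℝ, weilMellin v (1 / 2 + τ * I) = 0 := fun τ =>
      hall (show (1 / 2 + (τ : ℂ) * I) ∈ S by
        simp only [hSdef, Set.mem_setOf_eq, Complex.add_re, Complex.mul_re, Complex.ofReal_re,
          Complex.I_re, Complex.ofReal_im, Complex.I_im]
        norm_num)
    have hv0 : v =ᵐ[volume] 0 :=
      ae_eq_zero_of_weilMellin_criticalLine (integrable_of_weighted_all hvm hvI) hline
    apply hne
    refine integral_eq_zero_of_ae ?_
    filter_upwards [hv0] with t ht
    simp [ht]
  · intro s hs1 hs2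
    exact hne' s ⟨hs1, hs2⟩

/-- **Hurwitz signature, curried form.** [folklore] -/
theorem weakLimit_hurwitz (h₁ : GroundStateSimpleEven) {a : ℕ → ℝ} {u : ℕ → ℝ → ℂ} {c : ℕ → ℂ}
    {v : ℝ → ℂ} {b₀ M : ℝ} (ha : Tendsto a atTop atTop) (hu : ∀ k, IsWeilGroundState (a k) (u k))
    (hb₀ : 1 / 2 < b₀) (hM : ∀ k, ∫ t, ‖c k * u k t‖ * Real.exp (b₀ * |t|) ≤ M)
    (hv : LocallyIntegrable v volume)
    (hweak : ∀ g : ℝ → ℂ, IsWeilTest g →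
      Tendsto (fun k => ∫ t, c k * u k t * g t) atTop (𝓝 (∫ t, v t * g t))) :
    v =ᵐ[volume] 0 ∨ ∀ s : ℂ, 1 / 2 < s.re → s.re < 1 → weilMellin v s ≠ 0 :=
  stub_weakLimit_hurwitz h₁ a u c v b₀ M ha hu hb₀ hM hv hweak

/-! ## NV × IDENT ⇒ the crux -/

/-- **NV × IDENT ⇒ the crux (RH-free factorisation after rev L11).**  If along windows `a_k → ∞`
some renormalised ground states `c_k u_k` are tight in ONE `L¹(e^{b₀|t|})`, `b₀ > 1/2`, and converge
weakly against tests to a NON-ZERO MULTIPLE `m·Φ` of Riemann's kernel (NV: the limit is non-zero;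
IDENT: it is a multiple of `Φ`), then `GroundStatesConvergeToXi` holds (rescale by `m⁻¹`, transfer
by `tendstoLocallyUniformlyOn_of_tight_of_weak`; tightness for `b < 1/2` follows from `b₀ > 1/2`). [folklore] -/
theorem groundStatesConvergeToXi_of_weakLimit_const_mul_phi {a : ℕ → ℝ} {u : ℕ → ℝ → ℂ}
    {c : ℕ → ℂ} {b₀ M : ℝ} {m : ℂ} (ha : Tendsto a atTop atTop)
    (hu : ∀ k, IsWeilGroundState (a k) (u k)) (hc : ∀ k, c k ≠ 0) (hb₀ : 1 / 2 < b₀)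
    (hM : ∀ k, ∫ t, ‖c k * u k t‖ * Real.exp (b₀ * |t|) ≤ M) (hm : m ≠ 0)
    (hweak : ∀ g : ℝ → ℂ, IsWeilTest g →
      Tendsto (fun k => ∫ t, c k * u k t * g t) atTop
        (𝓝 (∫ t, m * (2 * LagariasMontague.Psic (2 * t)) * g t))) :
    Summit.RiemannHypothesis.RiemannHypothesis.Theses.WeilGroundState.GroundStatesConvergeToXi := by
  -- rescaled constants `c' = m⁻¹ c`
  have htight : ∀ b : ℝ, b < 1 / 2 → ∃ M' : ℝ, ∀ k,
      ∫ t, ‖m⁻¹ * c k * u k t‖ * Real.exp (b * |t|) ≤ M' := by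
    intro b hb
    refine ⟨‖m⁻¹‖ * M, fun k => ?_⟩
    have hle : ∫ t, ‖c k * u k t‖ * Real.exp (b * |t|) ≤ ∫ t, ‖c k * u k t‖ * Real.exp (b₀ * |t|) := by
      refine integral_mono_of_nonneg (ae_of_all _ fun t => by positivity) ?_ (ae_of_all _ fun t => ?_)
      · have h := ((hu k).integrable_norm_mul_exp b₀).const_mul ‖c k‖
        refine h.congr (ae_of_all _ fun t => ?_)
        simp only [norm_mul]
        ring
      · dsimp only
        refine mul_le_mul_of_nonneg_left ?_ (norm_nonneg _)
        exact Real.exp_le_exp.2 (mul_le_mul_of_nonneg_right (by linarith) (abs_nonneg t))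
    calc ∫ t, ‖m⁻¹ * c k * u k t‖ * Real.exp (b * |t|)
        = ‖m⁻¹‖ * ∫ t, ‖c k * u k t‖ * Real.exp (b * |t|) := by
          rw [← integral_const_mul]
          refine integral_congr_ae (ae_of_all _ fun t => ?_)
          simp only [norm_mul, mul_assoc]
      _ ≤ ‖m⁻¹‖ * M := mul_le_mul_of_nonneg_left (hle.trans (hM k)) (norm_nonneg _)
  have hweak' : ∀ g : ℝ → ℂ, IsWeilTest g →
      Tendsto (fun k => ∫ t, m⁻¹ * c k * u k t * g t) atTop
        (𝓝 (∫ t, 2 * LagariasMontague.Psic (2 * t) * g t)) := by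
    intro g hg
    have h := (hweak g hg).const_mul m⁻¹
    rw [← integral_const_mul] at h
    have e : (fun t => m⁻¹ * (m * (2 * LagariasMontague.Psic (2 * t)) * g t)) =
        fun t => 2 * LagariasMontague.Psic (2 * t) * g t := by
      funext t
      field_simp
    rw [e] at h
    refine h.congr fun k => ?_
    rw [← integral_const_mul]
    refine integral_congr_ae (ae_of_all _ fun t => ?_)
    ring
  exact ⟨a, u, fun k => m⁻¹ * c k, ha,
    fun k => ⟨(hu k).pos, mul_ne_zero (inv_ne_zero hm) (hc k), (hu k).1, (hu k).2⟩,
    tendstoLocallyUniformlyOn_of_tight_of_weak hu htight hweak'⟩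

end Summit.RiemannHypothesis.RiemannHypothesis.Theorems.GroundStatesConvergeToXi

end
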